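import Literature.Probability.RandomPlanarGeometry.HexSAWBoundaryWinding
import HarnessLib

/-!
# Duminil-Copin–Smirnov: Lemma 2, the strip identity `1 = c_α A + B + c_ε E`

Topic `Literature/Probability/RandomPlanarGeometry`; this file DISCHARGES the named fact
`Literature.Probability.RandomPlanarGeometry.SAW.DuminilCopinSmirnov2012_lemma2` (`HexSAWStrip.lean`);
Theorem 1 (`…DuminilCopinSmirnov2012_thm1_holds`) follows in `HexSAWTheorem1.lean` by
`DuminilCopinSmirnov2012_thm1_of_lemma2` (`HexSAWBridges.lean`).
Source: H. Duminil-Copin, S. Smirnov, *The connective constant of the honeycomb lattice equals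
`√(2+√2)`*, Ann. of Math. 175 (2012), 1653–1665 (arXiv:1007.0575): **Lemma 2** ("For critical
`x = x_c`, the following identity holds `1 = c_α A^{x_c}_{T,L} + B^{x_c}_{T,L} + c_ε E^{x_c}_{T,L}`,
with positive coefficients `c_α = cos(3π/8)` and `c_ε = cos(π/4)`. Proof. Sum the relation (2)
over all vertices in `V(S_{T,L})`. Values at interior mid-edges disappear and we arrive at the
identity `0 = -Σ_{z∈α} F(z) + Σ_{z∈β} F(z) + j Σ_{z∈ε} F(z) + j̄ Σ_{z∈ε̄} F(z)` (5) … the winding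
of any self-avoiding walk from `a` to the bottom part of `α` is `-π` while the winding to the top
part is `π` … `F(a) = 1` … the winding from `a` to any half-edge in `β` (resp. `ε` and `ε̄`) is
`0` (resp. `2π/3` and `-2π/3`) … The lemma follows readily by plugging the last three formulæ
into (5)") and **Theorem 1** ("For the hexagonal lattice, `μ = √(2+√2)`").

## Contents

* `HV.edir_wOut_hvOrigin`, `HV.emb_neg_one_neg_one`, `HV.emb_two_neg_one`: the four exit
  directions are `∓e₀`, `j e₀`, `j̄ e₀` with `e₀ = -1 + 2ω = i√3` the direction of `a`;
  `HV.cos_three_mul_θ₅`, `HV.cos_eighteen_mul_θ₅`, `HV.cos_thirty_mul_θ₅`: the real parts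
  `Re(-λ^{∓3}) = cos(3π/8)`, `Re(jλ²) = Re(j̄λ̄²) = cos(π/4)`.
* `HV.boundaryTerm_of_isBetaDart` (`= 1`), `HV.boundaryTerm_re_of_isAlphaDart` (`Re = c_α`),
  `HV.boundaryTerm_re_of_isEpsDart` (`Re = c_ε`): the boundary term `edir · λ^{pturn} / e₀` of a
  walk of each class, from the windings of `HexSAWBoundaryWinding`.
* **`DuminilCopinSmirnov2012_lemma2_holds : DuminilCopinSmirnov2012_lemma2`** — from the summed
  vertex relation `HV.boundary_sum` (Lemma 1, `HexSAWObservable`), the classification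
  `HV.boundary_iff`, division by `e₀` and real parts (DCS use the mirror symmetry of `S_{T,L}` to
  pair `z` with `z̄`; taking real parts achieves the same without it).
-/

noncomputable section

open Finset

namespace Literature.Probability.RandomPlanarGeometry.SAW

namespace HV

open Real Hopf

/-! ### Lemma 2: the strip identity `1 = c_α A + B + c_ε E` -/

section Lemma2

variable {T L : ℕ}

/-- The starting half-edge direction `e₀ = edir w O = -1 + 2ω = i√3`.
[cite: DuminilCopinSmirnov2012, §3] -/
theorem edir_wOut_hvOrigin : edir wOut hvOrigin = emb (-1, 2) := by
  rw [edir, pos_hvOrigin, pos_wOut]; rfl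

/-- `e₀ ≠ 0`. [folklore] -/
theorem emb_neg_one_two_ne_zero : emb (-1, 2) ≠ 0 := by
  rw [Ne, emb_eq_zero_iff]; simp

/-- `-1 - ω = ω² · (-1 + 2ω)`: the left-cut exit direction is `j e₀`. [folklore] -/
theorem emb_neg_one_neg_one : emb (-1, -1) = omg ^ 2 * emb (-1, 2) := by
  have h2 := omg_sq
  have h3 := omg_pow_three
  simp only [emb]; push_cast
  linear_combination h2 - 2 * h3

/-- `2 - ω = -ω · (-1 + 2ω)`: the right-cut exit direction is `j̄ e₀`. [folklore] -/
theorem emb_two_neg_one : emb (2, -1) = -omg * emb (-1, 2) := by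
  have h2 := omg_sq
  simp only [emb]; push_cast
  linear_combination (2 : ℂ) * h2

/-- `cos(3 θ) = -cos(3π/8)` (`3θ = -5π/8`). [folklore] -/
theorem cos_three_mul_θ₅ : Real.cos (3 * θ₅) = -Real.cos (3 * π / 8) := by
  rw [show 3 * θ₅ = -(π - 3 * π / 8) by simp only [θ₅]; ring, Real.cos_neg, Real.cos_pi_sub]

/-- `cos(18 θ) = cos(π/4)` (`18θ = -15π/4`). [folklore] -/
theorem cos_eighteen_mul_θ₅ : Real.cos (18 * θ₅) = Real.cos (π / 4) := by
  rw [show 18 * θ₅ = π / 4 - (2 : ℤ) * (2 * π) by simp only [θ₅]; push_cast; ring,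
    Real.cos_sub_int_mul_two_pi]

/-- `cos(30 θ) = cos(π/4)` (`30θ = -25π/4`). [folklore] -/
theorem cos_thirty_mul_θ₅ : Real.cos (30 * θ₅) = Real.cos (π / 4) := by
  rw [show 30 * θ₅ = -(π / 4) - (3 : ℤ) * (2 * π) by simp only [θ₅]; push_cast; ring,
    Real.cos_sub_int_mul_two_pi, Real.cos_neg]

/-- **Boundary term on `β`**: direction `e₀`, winding `0`: the term is `1`.
[cite: DuminilCopinSmirnov2012, proof of Lemma 2 ("Σ_{z ∈ β} F(z) = B")] -/
theorem boundaryTerm_of_isBetaDart {P : List HV} (hP : IsMidWalk (stripV T L) P)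
    (hβ : IsBetaDart T (finalDart P)) :
    edir (finalDart P).1 (finalDart P).2 * lam ^ pturn P / emb (-1, 2) = 1 := by
  have h0 := pturn_of_isBetaDart hP hβ
  rcases hP.trivial_or_exists with rfl | ⟨l, u, hl, rfl⟩
  · rw [finalDart_trivial, edir_wOut_hvOrigin, h0, zpow_zero, mul_one]
    exact div_self emb_neg_one_two_ne_zero
  rw [h0, zpow_zero, mul_one, finalDart_cons_append hl]
  rw [finalDart_cons_append hl] at hβ
  obtain ⟨-, h2, h3⟩ := hβ
  dsimp only at h2 h3 ⊢
  rw [edir, h3, show pos (l.getLast hl) = (3 * (l.getLast hl).1 + 2, 3 * (l.getLast hl).2.1 + 2) by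
    simp [pos, h2]]
  simp only [pos, Bool.false_eq_true, if_false]
  rw [show ((3 * (l.getLast hl).1 + 1, 3 * ((l.getLast hl).2.1 + 1) + 1) -
      (3 * (l.getLast hl).1 + 2, 3 * (l.getLast hl).2.1 + 2) : ℤ × ℤ) = (-1, 2) by
    simp only [Prod.mk_sub_mk, Prod.mk.injEq]; constructor <;> ring]
  exact div_self emb_neg_one_two_ne_zero

/-- **Boundary term on `α ∖ {a}`**: direction `-e₀`, winding `∓π`: the real part of the term is
`-cos(5π/8) = cos(3π/8) = c_α`.
[cite: DuminilCopinSmirnov2012, proof of Lemma 2 ("(e^{-iσπ}+e^{iσπ})/2 A = -cos(3π/8) A")] -/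
theorem boundaryTerm_re_of_isAlphaDart {P : List HV} (hP : IsMidWalk (stripV T L) P)
    (hα : IsAlphaDart (finalDart P)) :
    (edir (finalDart P).1 (finalDart P).2 * lam ^ pturn P / emb (-1, 2)).re =
      Real.cos (3 * π / 8) := by
  obtain ⟨hk, h0⟩ := pturn_of_isAlphaDart hP hα
  rcases hP.trivial_or_exists with rfl | ⟨l, u, hl, rfl⟩
  · exact absurd hα.1 (by simp [finalDart, wOut])
  rw [h0, finalDart_cons_append hl]
  rw [finalDart_cons_append hl] at hα hk
  obtain ⟨h1, h2, h3⟩ := hα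
  dsimp only at h1 h2 h3 hk ⊢
  have he : edir (l.getLast hl) u = -emb (-1, 2) := by
    rw [edir, h3,
      show pos (l.getLast hl) = (3 * (l.getLast hl).1 + 1, 1) by simp [pos, h2, h1]]
    simp only [pos, if_true, ← emb_neg]
    congr 1; simp only [Prod.mk_sub_mk, Prod.neg_mk, Prod.mk.injEq]; constructor <;> ring
  rw [he, neg_mul, neg_div, mul_div_right_comm, div_self emb_neg_one_two_ne_zero, one_mul,
    Complex.neg_re, lam_zpow_re]
  rcases lt_or_gt_of_ne hk with hk' | hk'
  · rw [Int.sign_eq_neg_one_of_neg hk', show (((-(3 * (-1)) : ℤ) : ℝ)) = 3 by norm_num,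
      cos_three_mul_θ₅, neg_neg]
  · rw [Int.sign_eq_one_of_pos hk',
      show (((-(3 * 1) : ℤ) : ℝ)) * θ₅ = -(3 * θ₅) by push_cast; ring, Real.cos_neg,
      cos_three_mul_θ₅, neg_neg]

/-- **Boundary term on `ε ∪ ε̄`**: directions `j e₀`, `j̄ e₀`, windings `±2π/3`: the real part
of the term is `cos(π/4) = c_ε`.
[cite: DuminilCopinSmirnov2012, proof of Lemma 2 ("j Σ_ε F + j̄ Σ_ε̄ F = cos(π/4) E")] -/
theorem boundaryTerm_re_of_isEpsDart {P : List HV} (hP : IsMidWalk (stripV T L) P)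
    (hε : IsEpsDart L (finalDart P)) :
    (edir (finalDart P).1 (finalDart P).2 * lam ^ pturn P / emb (-1, 2)).re =
      Real.cos (π / 4) := by
  have h0 := pturn_of_isEpsDart hP hε
  rcases hP.trivial_or_exists with rfl | ⟨l, u, hl, rfl⟩
  · exfalso; rcases hε.2 with ⟨-, h⟩ | ⟨-, h⟩ <;> simp [finalDart, wOut, hvOrigin] at h
  rw [finalDart_cons_append hl]
  rw [finalDart_cons_append hl] at hε h0
  obtain ⟨h2, hε⟩ := hε
  dsimp only at h2 hε h0 ⊢
  have hposv : pos (l.getLast hl) = (3 * (l.getLast hl).1 + 2, 3 * (l.getLast hl).2.1 + 2) := by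
    simp [pos, h2]
  rcases hε with ⟨-, h3⟩ | ⟨-, h3⟩
  · -- left cut
    rcases h0 with ⟨-, h0⟩ | ⟨h0, -⟩
    swap; · exfalso; rw [h3] at h0; simp at h0
    have he : edir (l.getLast hl) u = omg ^ 2 * emb (-1, 2) := by
      rw [edir, h3, hposv, ← emb_neg_one_neg_one]
      simp only [pos, Bool.false_eq_true, if_false]
      congr 1; simp only [Prod.mk_sub_mk, Prod.mk.injEq]; constructor <;> ring
    rw [h0, he, mul_div_right_comm, mul_div_assoc, div_self emb_neg_one_two_ne_zero, mul_one,
      omg_sq, ← lam_zpow_sixteen, ← zpow_add₀ lam_ne_zero, lam_zpow_re,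
      show (((16 + 2 : ℤ)) : ℝ) = 18 by norm_num]
    exact cos_eighteen_mul_θ₅
  · -- right cut
    rcases h0 with ⟨h0, -⟩ | ⟨-, h0⟩
    · exfalso; rw [h3] at h0; simp at h0
    have he : edir (l.getLast hl) u = -omg * emb (-1, 2) := by
      rw [edir, h3, hposv, ← emb_two_neg_one]
      simp only [pos, Bool.false_eq_true, if_false]
      congr 1; simp only [Prod.mk_sub_mk, Prod.mk.injEq]; constructor <;> ring
    have h32 : -omg = lam ^ (32 : ℤ) := by
      rw [show (32 : ℤ) = 16 + 16 by norm_num, zpow_add₀ lam_ne_zero, lam_zpow_sixteen, ← omg_sq,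
        ← pow_add, show 2 + 2 = 3 + 1 by norm_num, pow_add, omg_pow_three]; ring
    rw [h0, he, mul_div_right_comm, mul_div_assoc, div_self emb_neg_one_two_ne_zero, mul_one,
      h32, ← zpow_add₀ lam_ne_zero, lam_zpow_re, show (((32 + -2 : ℤ)) : ℝ) = 30 by norm_num]
    exact cos_thirty_mul_θ₅

/-- The boundary term of the summed vertex relation, divided by `e₀`, has real part
`x_c^{ℓ} · Re(boundary term / e₀)`. [cite: DuminilCopinSmirnov2012, proof of Lemma 2] -/
theorem re_div_e₀ (P : List HV) :
    (edir (finalDart P).1 (finalDart P).2 * pwt P / emb (-1, 2)).re =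
      hexCriticalFugacity ^ mwLen P *
        (edir (finalDart P).1 (finalDart P).2 * lam ^ pturn P / emb (-1, 2)).re := by
  rw [pwt, show edir (finalDart P).1 (finalDart P).2 *
      ((hexCriticalFugacity : ℂ) ^ mwLen P * lam ^ pturn P) / emb (-1, 2) =
        ((hexCriticalFugacity ^ mwLen P : ℝ) : ℂ) *
          (edir (finalDart P).1 (finalDart P).2 * lam ^ pturn P / emb (-1, 2)) by push_cast; ring]
  exact Complex.re_ofReal_mul _ _

end Lemma2

end HV

/-! ### Duminil-Copin–Smirnov's Lemma 2 -/

section Main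

open HV Real

/-- **Duminil-Copin–Smirnov 2012, Lemma 2** (discharge of the named fact
`DuminilCopinSmirnov2012_lemma2` of `HexSAWStrip.lean`): for every strip domain `S_{T,L}`, `T ≥ 1`,
`1 = cos(3π/8) A_{T,L}^{x_c} + B_{T,L}^{x_c} + cos(π/4) E_{T,L}^{x_c}`. Proof as in print: sum the
vertex relation (Lemma 1, `HV.vertex_relation`) over `V(S_{T,L})` (`HV.boundary_sum`), classify
the boundary half-edges (`HV.boundary_iff`), insert the boundary windings `∓π`, `0`, `±2π/3`
(`HV.pturn_of_isAlphaDart/BetaDart/EpsDart`, from the discrete Hopf Umlaufsatz `HV.hopf_path`),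
divide by the direction of `a` and take real parts. [cite: DuminilCopinSmirnov2012, Lemma 2] -/
theorem DuminilCopinSmirnov2012_lemma2_holds : DuminilCopinSmirnov2012_lemma2 := by
  intro T L hT
  have hbs := boundary_sum (V := stripV T L) stripV_upper (hvOrigin_mem_stripV hT)
  rw [edir_wOut_hvOrigin, Finset.sum_filter] at hbs
  -- pointwise identification of the real part of each boundary term divided by `e₀`
  have hpt : ∀ P ∈ midWalks (stripV T L),
      ((if P ≠ [wOut, hvOrigin] ∧ (finalDart P).2 ∉ stripV T L then
          edir (finalDart P).1 (finalDart P).2 * pwt P else 0) / emb (-1, 2)).re =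
        hexCriticalFugacity ^ mwLen P *
          ((if IsAlphaDart (finalDart P) then Real.cos (3 * π / 8) else 0) +
            (if IsBetaDart T (finalDart P) then 1 else 0) +
            (if IsEpsDart L (finalDart P) then Real.cos (π / 4) else 0)) := by
    intro P hP
    rw [mem_midWalks_iff] at hP
    have hiff := boundary_iff hT hP
    by_cases hα : IsAlphaDart (finalDart P)
    · rw [if_pos (hiff.2 (Or.inl hα)), re_div_e₀, boundaryTerm_re_of_isAlphaDart hP hα, if_pos hα,
        if_neg (not_isBetaDart_of_isAlphaDart hα), if_neg (not_isEpsDart_of_isAlphaDart hα)]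
      ring
    by_cases hβ : IsBetaDart T (finalDart P)
    · rw [if_pos (hiff.2 (Or.inr (Or.inl hβ))), re_div_e₀, boundaryTerm_of_isBetaDart hP hβ,
        Complex.one_re, if_neg hα, if_pos hβ, if_neg (not_isEpsDart_of_isBetaDart hβ)]
      ring
    by_cases hε : IsEpsDart L (finalDart P)
    · rw [if_pos (hiff.2 (Or.inr (Or.inr hε))), re_div_e₀, boundaryTerm_re_of_isEpsDart hP hε,
        if_neg hα, if_neg hβ, if_pos hε]
      ring
    · rw [if_neg (by rw [hiff]; push Not; exact ⟨hα, hβ, hε⟩), zero_div, Complex.zero_re,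
        if_neg hα, if_neg hβ, if_neg hε]
      ring
  have key := congrArg (fun z => (z / emb (-1, 2)).re) hbs
  rw [div_self emb_neg_one_two_ne_zero, Complex.one_re, Finset.sum_div, Complex.re_sum,
    Finset.sum_congr rfl hpt] at key
  -- regroup the three classes
  have hA : ∑ P ∈ midWalks (stripV T L), hexCriticalFugacity ^ mwLen P *
      (if IsAlphaDart (finalDart P) then Real.cos (3 * π / 8) else 0) =
        Real.cos (3 * π / 8) * stripA T L hexCriticalFugacity := by
    rw [stripA, Finset.mul_sum, Finset.sum_filter]
    refine Finset.sum_congr rfl fun P _ => ?_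
    split_ifs <;> ring
  have hB : ∑ P ∈ midWalks (stripV T L), hexCriticalFugacity ^ mwLen P *
      (if IsBetaDart T (finalDart P) then (1 : ℝ) else 0) = stripB T L hexCriticalFugacity := by
    rw [stripB, Finset.sum_filter]
    refine Finset.sum_congr rfl fun P _ => ?_
    split_ifs <;> ring
  have hE : ∑ P ∈ midWalks (stripV T L), hexCriticalFugacity ^ mwLen P *
      (if IsEpsDart L (finalDart P) then Real.cos (π / 4) else 0) =
        Real.cos (π / 4) * stripE T L hexCriticalFugacity := by
    rw [stripE, Finset.mul_sum, Finset.sum_filter]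
    refine Finset.sum_congr rfl fun P _ => ?_
    split_ifs <;> ring
  rw [← key, ← hA, ← hB, ← hE, ← Finset.sum_add_distrib, ← Finset.sum_add_distrib]
  refine Finset.sum_congr rfl fun P _ => ?_
  ring

end Main

end Literature.Probability.RandomPlanarGeometry.SAW
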